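import Mathlib
import Literature.AlgebraicGeometry.Ramification.InertiaDVRNormalSylow
import HarnessLib

/-!
# Ring-theoretic inertia groups at height-one primes are p-closed

Affine/ring-level corollary of `InertiaDVRNormalSylow.lean`
(`hasNormalSylow_of_faithful_residueTrivial_action`: a finite group acting faithfully on a
discrete valuation ring of characteristic `p`, trivially on the residue field, has a normal
Sylow `p`-subgroup). Let a finite group `G` act faithfully on an integral domain `A` of
characteristic `p`, and let `𝔭` be a prime of `A` at which the localisation `A_𝔭` is a discrete
valuation ring (e.g. `A` Noetherian normal and `ht 𝔭 = 1`). The **ring inertia group** at `𝔭` —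
any subgroup `D` whose elements satisfy `g a - a ∈ 𝔭` for all `a ∈ A` (they fix `𝔭` and act
trivially on `A/𝔭`; for the action on `Spec A` this is Abbes–Saito's inertia group `I_𝔭` of the
point `𝔭`, AS2011 2.4) — has a normal Sylow `p`-subgroup. This is property (NpS) at points of
codimension one of a normal `G`-scheme, the classical input "the non-p-closed locus has
codimension `≥ 2`" of the inertia-stratum analysis (Serre, *Corps locaux* IV §2 Cor. 4).

Proof: `D` acts on `A_𝔭` through `IsLocalization.ringEquivOfRingEquiv` (the complement of `𝔭`
is stable), faithfully (`A ⊆ A_𝔭`), with `g(x) - x ∈ 𝔭A_𝔭` for all `x = a/s`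
(`g(a)s - a g(s) = (g a - a)s - a(g s - s) ∈ 𝔭`); apply the DVR theorem.

* `primeCompl_map_eq_of_forall_sub_mem` — the complement of `𝔭` is stable under `D`.
* `hasNormalSylow_of_forall_sub_mem_prime` — the theorem.
-/

namespace Literature.AlgebraicGeometry.Ramification

open IsLocalRing

variable {A : Type*} [CommRing A]

/-- If `g a - a ∈ 𝔭` for all `a` (and the same for `g⁻¹`, automatic in a subgroup), then `g`
maps the complement of the prime `𝔭` onto itself. [folklore] -/
theorem primeCompl_map_eq_of_forall_sub_mem {G : Type*} [Group G] (σ : G →* (A ≃+* A))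
    (𝔭 : Ideal A) [𝔭.IsPrime] (D : Subgroup G) (hD : ∀ g ∈ D, ∀ a : A, σ g a - a ∈ 𝔭)
    (g : G) (hg : g ∈ D) : 𝔭.primeCompl.map (σ g).toMonoidHom = 𝔭.primeCompl := by
  ext s
  simp only [Submonoid.mem_map, Ideal.mem_primeCompl_iff]
  constructor
  · rintro ⟨t, ht, rfl⟩ hst
    change σ g t ∈ 𝔭 at hst
    exact ht (by simpa using Ideal.sub_mem 𝔭 hst (hD g hg t))
  · intro hs
    refine ⟨σ g⁻¹ s, fun ht => hs ?_, ?_⟩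
    · have := Ideal.sub_mem 𝔭 ht (hD g⁻¹ (D.inv_mem hg) s)
      simpa using this
    · change σ g (σ g⁻¹ s) = s
      rw [← RingAut.mul_apply, ← map_mul, mul_inv_cancel, map_one, RingAut.one_apply]

/-- **Ring inertia groups at height-one primes are p-closed** (Serre IV §2 Cor. 4 / AS2011 (NpS)
in codimension one, ring form): `G` finite acting faithfully on a domain `A` of characteristic
`p`, `𝔭` a prime with `A_𝔭` a discrete valuation ring, `D ≤ G` a subgroup with `g a - a ∈ 𝔭` for
all `g ∈ D`, `a ∈ A`. Then `D` has a normal Sylow `p`-subgroup. [cite: Serre1979, Ch. IV §2 Cor. 4] -/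
theorem hasNormalSylow_of_forall_sub_mem_prime (p : ℕ) [Fact p.Prime] [IsDomain A] [CharP A p]
    {G : Type*} [Group G] [Finite G] (σ : G →* (A ≃+* A)) (hσ : Function.Injective σ)
    (𝔭 : Ideal A) [h𝔭 : 𝔭.IsPrime] [IsDiscreteValuationRing (Localization.AtPrime 𝔭)]
    (D : Subgroup G) (hD : ∀ g ∈ D, ∀ a : A, σ g a - a ∈ 𝔭) : HasNormalSylow p D := by
  classical
  have hinj : Function.Injective (algebraMap A (Localization.AtPrime 𝔭)) :=
    IsLocalization.injective (Localization.AtPrime 𝔭) 𝔭.primeCompl_le_nonZeroDivisors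
  haveI : CharP (Localization.AtPrime 𝔭) p := charP_of_injective_algebraMap hinj p
  have Hmap : ∀ g : D, 𝔭.primeCompl.map (σ g).toMonoidHom = 𝔭.primeCompl := fun g =>
    primeCompl_map_eq_of_forall_sub_mem σ 𝔭 D hD g g.2
  -- the localised action `τ : D →* Aut(A_𝔭)`
  let τ₀ : D → ((Localization.AtPrime 𝔭) ≃+* (Localization.AtPrime 𝔭)) := fun g =>
    IsLocalization.ringEquivOfRingEquiv (Localization.AtPrime 𝔭) (Localization.AtPrime 𝔭) (σ g) (Hmap g)
  have hτ₀ : ∀ (g : D) (a : A), τ₀ g (algebraMap A (Localization.AtPrime 𝔭) a) = algebraMap A (Localization.AtPrime 𝔭) (σ g a) := fun g a =>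
    IsLocalization.ringEquivOfRingEquiv_eq (Hmap g) a
  have hext : ∀ (φ ψ : (Localization.AtPrime 𝔭) ≃+* (Localization.AtPrime 𝔭)), (∀ a : A, φ (algebraMap A (Localization.AtPrime 𝔭) a) = ψ (algebraMap A (Localization.AtPrime 𝔭) a)) →
      φ = ψ := by
    intro φ ψ h
    apply RingEquiv.ext
    intro x
    have := IsLocalization.ringHom_ext 𝔭.primeCompl (j := (φ : (Localization.AtPrime 𝔭) →+* (Localization.AtPrime 𝔭))) (k := (ψ : (Localization.AtPrime 𝔭) →+* (Localization.AtPrime 𝔭)))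
      (RingHom.ext fun a => by simp only [RingHom.comp_apply, RingHom.coe_coe]; exact h a)
    exact RingHom.congr_fun this x
  obtain ⟨τ, hτ⟩ : ∃ τ : D →* ((Localization.AtPrime 𝔭) ≃+* (Localization.AtPrime 𝔭)), ∀ g, τ g = τ₀ g :=
    ⟨{ toFun := τ₀
       map_one' := hext _ _ fun a => by
         rw [hτ₀, RingAut.one_apply]; simp
       map_mul' := fun g h => hext _ _ fun a => by
         rw [hτ₀, RingAut.mul_apply, hτ₀, hτ₀, Subgroup.coe_mul, map_mul, RingAut.mul_apply] },
      fun g => rfl⟩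
  -- faithful
  have hτinj : Function.Injective τ := by
    intro g h hgh
    have key : ∀ a : A, σ g a = σ h a := fun a => hinj (by rw [← hτ₀, ← hτ₀, ← hτ, ← hτ, hgh])
    have : (g : G) = h := hσ (RingEquiv.ext key)
    exact Subtype.ext this
  -- residue-trivial
  have hres : ∀ (g : D) (x : (Localization.AtPrime 𝔭)), τ g x - x ∈ maximalIdeal (Localization.AtPrime 𝔭) := by
    intro g x
    obtain ⟨a, s, rfl⟩ := IsLocalization.exists_mk'_eq 𝔭.primeCompl x
    have hs : IsUnit (algebraMap A (Localization.AtPrime 𝔭) s) := IsLocalization.map_units (Localization.AtPrime 𝔭) s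
    have hgs : IsUnit (algebraMap A (Localization.AtPrime 𝔭) (σ g s)) := by
      have hmem : σ g s ∈ 𝔭.primeCompl := by
        refine Ideal.mem_primeCompl_iff.mpr fun hmem => Ideal.mem_primeCompl_iff.mp s.2 ?_
        have := Ideal.sub_mem 𝔭 hmem (hD g g.2 s)
        simpa using this
      exact IsLocalization.map_units (Localization.AtPrime 𝔭) (⟨σ g s, hmem⟩ : 𝔭.primeCompl)
    rw [← Ideal.mul_unit_mem_iff_mem _ (hs.mul hgs)]
    have e1 : IsLocalization.mk' (Localization.AtPrime 𝔭) a s * algebraMap A (Localization.AtPrime 𝔭) s = algebraMap A (Localization.AtPrime 𝔭) a :=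
      IsLocalization.mk'_spec (Localization.AtPrime 𝔭) a s
    have e2 : τ g (IsLocalization.mk' (Localization.AtPrime 𝔭) a s) * algebraMap A (Localization.AtPrime 𝔭) (σ g s) = algebraMap A (Localization.AtPrime 𝔭) (σ g a) := by
      have := congrArg (τ g) e1
      rw [map_mul, hτ, hτ₀, hτ₀] at this
      rw [hτ]; exact this
    have e3 : (τ g (IsLocalization.mk' (Localization.AtPrime 𝔭) a s) - IsLocalization.mk' (Localization.AtPrime 𝔭) a s) *
        (algebraMap A (Localization.AtPrime 𝔭) s * algebraMap A (Localization.AtPrime 𝔭) (σ g s)) =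
        algebraMap A (Localization.AtPrime 𝔭) (σ g a * s - a * σ g s) := by
      rw [map_sub, map_mul, map_mul, ← e1, ← e2]; ring
    rw [e3, ← Localization.AtPrime.map_eq_maximalIdeal]
    refine Ideal.mem_map_of_mem _ ?_
    have e4 : σ g a * s - a * σ g s = (σ g a - a) * s - a * (σ g s - s) := by ring
    rw [e4]
    exact Ideal.sub_mem _ (Ideal.mul_mem_right _ _ (hD g g.2 a))
      (Ideal.mul_mem_left _ _ (hD g g.2 s))
  exact hasNormalSylow_of_faithful_residueTrivial_action p τ hτinj hres

end Literature.AlgebraicGeometry.Ramification
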